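import Literature.AnabelianGeometry.SemiGraphs.TemperedPiQuotientFibre
import Literature.AnabelianGeometry.SemiGraphs.TemperedPiFibreMap

/-!
# Orbits of `π₁^temp(𝒢)`-sets as fibres of quotient coverings ([SemiAnbd] Prop. 3.6 (ii), p. 38)

For Galois level data `D` (levels splitting themselves, e.g. point-transitive) and an object `X` of
`B^temp(π₁^temp(𝒢))` with a point `x₀`: the open stabiliser `H` of `x₀` contains `ker ρ_n` for
some `n` (`exists_level_stab`); with `K := ρ_n(H) ≤ G_n`, the fibre over `v₀` of the quotient
covering `𝒢_{∞,n}/K`, with its `π₁^temp`-action, receives the orbit of `x₀` equivariantly and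
bijectively (`γ · x₀ ↦ γ · [bp]`).  This is the transitive case of the essential surjectivity of
the fibre functor.
-/

namespace Literature.AnabelianGeometry.SemiGraphs

namespace ProfiniteSemiGraph

open CategoryTheory Topology

universe u

variable {𝒢 : ProfiniteSemiGraph.{u}}

namespace GaloisLevelData

variable (D : GaloisLevelData 𝒢) (h𝒢 : 𝒢.IsCountable)

/-- The kernels of the projections `ρ_n` form a basis of neighbourhoods of `1` in `π₁^temp(𝒢)`.
[cite: MochizukiSemiAnbd2006, Prop 3.6(i) p.38] -/
theorem exists_ker_proj_subset {U : Set (D.temperedPi h𝒢)} (hU : U ∈ 𝓝 (1 : D.temperedPi h𝒢)) :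
    ∃ n : ℕ, ∀ γ : D.temperedPi h𝒢, D.proj h𝒢 n γ = 1 → γ ∈ U := by
  obtain ⟨u, hu, hsub⟩ := (mem_nhds_subtype _ _ _).mp hU
  have hu' : u ∈ 𝓝 (1 : ∀ i, (D.system h𝒢).obj i) := hu
  rw [nhds_pi, Filter.mem_pi] at hu'
  obtain ⟨I, hI, t, ht, hIt⟩ := hu'
  obtain ⟨k, hk⟩ := hI.toFinset.exists_le
  refine ⟨k.down, fun γ hγ => ?_⟩
  have hmem : γ.1 ∈ I.pi t := by
    intro i hi
    have hik : i ≤ k := hk i (hI.mem_toFinset.mpr hi)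
    have e : γ.1 i = 1 := by
      have h2 := D.mapLE_proj h𝒢 (show i.down ≤ k.down from hik) γ
      change D.mapLE h𝒢 _ (D.proj h𝒢 k.down γ) = γ.1 i at h2
      rw [← h2, hγ, map_one]
      rfl
    rw [e]
    have := ht i
    rwa [nhds_discrete, Filter.mem_pure] at this
  exact hsub (hIt hmem)

variable (X : BTemp (D.temperedPi h𝒢)) (x₀ : X.obj.V)

/-- The stabiliser of `x₀` as a subgroup of `π₁^temp(𝒢)`. [cite: MochizukiSemiAnbd2006, Prop 3.6(ii) p.38] -/
def stabSub : Subgroup (D.temperedPi h𝒢) where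
  carrier := {γ | X.obj.ρ γ x₀ = x₀}
  one_mem' := by
    change X.obj.ρ 1 x₀ = x₀
    rw [map_one]; rfl
  mul_mem' := by
    intro a b ha hb
    change X.obj.ρ (a * b) x₀ = x₀
    rw [map_mul]
    change X.obj.ρ a (X.obj.ρ b x₀) = x₀
    rw [hb, ha]
  inv_mem' := by
    intro a ha
    change X.obj.ρ a⁻¹ x₀ = x₀
    have h := congrArg (fun z => X.obj.ρ a⁻¹ z) ha
    change (X.obj.ρ a ≫ X.obj.ρ a⁻¹) x₀ = _ at h
    rw [← End.mul_def, ← map_mul, inv_mul_cancel, map_one] at h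
    exact h.symm

/-- Some `ker ρ_n` fixes `x₀` (the stabiliser is open). [cite: MochizukiSemiAnbd2006, Prop 3.6(ii) p.38] -/
theorem exists_level_stab : ∃ n : ℕ, ∀ γ : D.temperedPi h𝒢, D.proj h𝒢 n γ = 1 → X.obj.ρ γ x₀ = x₀ := by
  have hopen : IsOpen {γ : D.temperedPi h𝒢 | X.obj.ρ γ x₀ = x₀} := X.property.2 x₀
  have h1 : {γ : D.temperedPi h𝒢 | X.obj.ρ γ x₀ = x₀} ∈ 𝓝 (1 : D.temperedPi h𝒢) :=
    hopen.mem_nhds (by change X.obj.ρ 1 x₀ = x₀; rw [map_one]; rfl)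
  exact D.exists_ker_proj_subset h𝒢 h1

/-- The level of `x₀`. [cite: MochizukiSemiAnbd2006, Prop 3.6(ii) p.38] -/
noncomputable def stabLevel : ℕ := (D.exists_level_stab h𝒢 X x₀).choose

/-- The kernel of `ρ_n`, `n` the level of `x₀`, fixes `x₀`. [cite: MochizukiSemiAnbd2006, Prop 3.6(ii) p.38] -/
theorem stabLevel_spec (γ : D.temperedPi h𝒢) (hγ : D.proj h𝒢 (D.stabLevel h𝒢 X x₀) γ = 1) :
    X.obj.ρ γ x₀ = x₀ :=
  (D.exists_level_stab h𝒢 X x₀).choose_spec γ hγ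

/-- `K := ρ_n(H) ≤ G_n`. [cite: MochizukiSemiAnbd2006, Prop 3.6(ii) p.38] -/
noncomputable def stabImage : Subgroup (D.Gal h𝒢 (D.stabLevel h𝒢 X x₀)) :=
  (D.stabSub h𝒢 X x₀).map (D.proj h𝒢 (D.stabLevel h𝒢 X x₀))

/-- `ρ_n⁻¹(K) = H` (since `ker ρ_n ⊆ H`). [cite: MochizukiSemiAnbd2006, Prop 3.6(ii) p.38] -/
theorem mem_stabSub_of_proj_mem (γ : D.temperedPi h𝒢)
    (h : D.proj h𝒢 (D.stabLevel h𝒢 X x₀) γ ∈ D.stabImage h𝒢 X x₀) : X.obj.ρ γ x₀ = x₀ := by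
  obtain ⟨η, hη, hηγ⟩ := Subgroup.mem_map.mp h
  have hk : D.proj h𝒢 (D.stabLevel h𝒢 X x₀) (η⁻¹ * γ) = 1 := by
    rw [map_mul, map_inv, hηγ, inv_mul_cancel]
  have h1 := D.stabLevel_spec h𝒢 X x₀ (η⁻¹ * γ) hk
  have h2 : X.obj.ρ η⁻¹ x₀ = x₀ := (D.stabSub h𝒢 X x₀).inv_mem hη
  have e : γ = η * (η⁻¹ * γ) := by rw [mul_inv_cancel_left]
  rw [e, map_mul]
  change X.obj.ρ η (X.obj.ρ (η⁻¹ * γ) x₀) = x₀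
  rw [h1]
  exact hη

/-- The quotient covering `Q_{x₀} := 𝒢_{∞,n}/ρ_n(H)` attached to `x₀`. [cite: MochizukiSemiAnbd2006, Prop 3.6(ii) p.38] -/
noncomputable abbrev orbitCover : CovObj 𝒢 :=
  D.quotCover h𝒢 (D.stabLevel h𝒢 X x₀) (D.stabImage h𝒢 X x₀)

variable (hS : ∀ n, (D.S n).Splits (D.S n))

include hS in
/-- Level data for `Q_{x₀}`: the constant level `n`. [cite: MochizukiSemiAnbd2006, Prop 3.6(ii) p.38] -/
theorem orbitCover_hlev (t : ((D.orbitCover h𝒢 X x₀).SV D.v₀).obj.V) (m : ℕ)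
    (hm : D.stabLevel h𝒢 X x₀ ≤ m) :
    (D.S m).Splits ((D.orbitCover h𝒢 X x₀).component (Sum.inl ⟨D.v₀, t⟩)) :=
  D.splits_quot_component h𝒢 _ _ (hS _) _ m hm

/-- The `π₁^temp`-action on the base point of `Q_{x₀}`: `γ · [bp] = [ρ_n(γ)⁻¹ bp]`.
[cite: MochizukiSemiAnbd2006, Prop 3.6(ii) p.38] -/
theorem piAct_quotBase (γ : D.temperedPi h𝒢) :
    D.piAct h𝒢 (D.orbitCover h𝒢 X x₀) (fun _ => D.stabLevel h𝒢 X x₀) (D.orbitCover_hlev h𝒢 X x₀ hS) γ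
        (D.quotBase h𝒢 _ _) =
      (((D.cover h𝒢 _).quotMk (D.stabImage h𝒢 X x₀)).fV D.v₀).hom.hom
        ((((D.proj h𝒢 (D.stabLevel h𝒢 X x₀) γ)⁻¹ : D.Gal h𝒢 _).hom.fV D.v₀).hom.hom (D.bp _)) :=
  D.actAt_quotBase h𝒢 _ _ _ _

/-- The stabiliser `H` fixes `[bp]`. [cite: MochizukiSemiAnbd2006, Prop 3.6(ii) p.38] -/
theorem piAct_quotBase_eq_of_mem (η : D.temperedPi h𝒢) (hη : X.obj.ρ η x₀ = x₀) :
    D.piAct h𝒢 (D.orbitCover h𝒢 X x₀) (fun _ => D.stabLevel h𝒢 X x₀) (D.orbitCover_hlev h𝒢 X x₀ hS) η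
        (D.quotBase h𝒢 _ _) = D.quotBase h𝒢 _ _ := by
  rw [D.piAct_quotBase h𝒢 X x₀ hS]
  exact (D.quotMk_aut_bp_eq_iff h𝒢 _ _ ((D.proj h𝒢 _ η)⁻¹) 1).mpr (by
    rw [inv_inv, one_mul]
    exact Subgroup.mem_map.mpr ⟨η, hη, rfl⟩)

/-- **Points of the quotient fibre with equal `γ`-translates of `[bp]`**: `γ · [bp] = γ' · [bp]`
iff `γ x₀ = γ' x₀`. [cite: MochizukiSemiAnbd2006, Prop 3.6(ii) p.38] -/
theorem piAct_quotBase_eq_iff (γ γ' : D.temperedPi h𝒢) :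
    D.piAct h𝒢 (D.orbitCover h𝒢 X x₀) (fun _ => D.stabLevel h𝒢 X x₀) (D.orbitCover_hlev h𝒢 X x₀ hS) γ
        (D.quotBase h𝒢 _ _) =
      D.piAct h𝒢 (D.orbitCover h𝒢 X x₀) (fun _ => D.stabLevel h𝒢 X x₀) (D.orbitCover_hlev h𝒢 X x₀ hS) γ'
        (D.quotBase h𝒢 _ _) ↔ X.obj.ρ γ x₀ = X.obj.ρ γ' x₀ := by
  rw [D.piAct_quotBase h𝒢 X x₀ hS, D.piAct_quotBase h𝒢 X x₀ hS, D.quotMk_aut_bp_eq_iff, inv_inv,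
    ← map_inv, ← map_mul]
  constructor
  · intro h
    have h1 := D.mem_stabSub_of_proj_mem h𝒢 X x₀ _ h
    -- `γ'⁻¹ γ x₀ = x₀`
    have h2 := congrArg (fun z => X.obj.ρ γ' z) h1
    change (X.obj.ρ (γ'⁻¹ * γ) ≫ X.obj.ρ γ') x₀ = _ at h2
    rw [← End.mul_def, ← map_mul, mul_inv_cancel_left] at h2
    exact h2
  · intro h
    apply Subgroup.mem_map.mpr
    refine ⟨γ'⁻¹ * γ, ?_, rfl⟩
    change X.obj.ρ (γ'⁻¹ * γ) x₀ = x₀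
    rw [map_mul]
    change X.obj.ρ γ'⁻¹ (X.obj.ρ γ x₀) = x₀
    rw [h]
    change (X.obj.ρ γ' ≫ X.obj.ρ γ'⁻¹) x₀ = x₀
    rw [← End.mul_def, ← map_mul, inv_mul_cancel, map_one]
    rfl

/-- Every point of the quotient fibre over `v₀` is a `π₁^temp`-translate of `[bp]`.
[cite: MochizukiSemiAnbd2006, Prop 3.6(ii) p.38] -/
theorem exists_piAct_quotBase (q : ((D.orbitCover h𝒢 X x₀).SV D.v₀).obj.V) :
    ∃ γ : D.temperedPi h𝒢,
      D.piAct h𝒢 (D.orbitCover h𝒢 X x₀) (fun _ => D.stabLevel h𝒢 X x₀) (D.orbitCover_hlev h𝒢 X x₀ hS) γ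
        (D.quotBase h𝒢 _ _) = q := by
  obtain ⟨σ, rfl⟩ := D.exists_quotMk_aut_bp h𝒢 _ _ q
  obtain ⟨γ, hγ⟩ := D.proj_surjective h𝒢 _ σ⁻¹
  refine ⟨γ, ?_⟩
  rw [D.piAct_quotBase h𝒢 X x₀ hS, hγ, inv_inv]

end GaloisLevelData

end ProfiniteSemiGraph

end Literature.AnabelianGeometry.SemiGraphs
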